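import Summits.BirchSwinnertonDyer.Rank1Residual.Additive.QuadraticBranchPlusEtaNodes
import Summits.BirchSwinnertonDyer.BirchSwinnertonDyer.Theorems.QuadraticBranchSignedControlPlusEtaMainConjectureSeam
import Summits.BirchSwinnertonDyer.BirchSwinnertonDyer.Theorems.QuadraticBranchSignedControlPlusEtaSeam
import HarnessLib

/-!
# Route `QuadraticBranchSignedControl` (rung K8, cell `bsd-potss`): the K8 even-main-conjecture items
# RESTATED IN NODE CURRENCY — 19114 / 19243 ⟺ `∀ V p, … → QuadraticBranchPlusEtaMainConjectureAt V p`,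
# 19242 ⟺ `∀ V p, … → QuadraticBranchPlusEtaLowerInclusionAt V p` (granted the frames), and the
# `η`-currency unit rows (NO frame)

WHAT. The node file `Additive/QuadraticBranchPlusEtaNodes.lean` (p427065) declares Kobayashi's even
main conjecture AT `η` and its Eisenstein half VERBATIM on the `η`-component object `X⁺(V/K_∞)^η` as
`@[conjecture] def`s `QuadraticBranchPlusEtaMainConjectureAt V p` (C1⁺_η) /
`QuadraticBranchPlusEtaLowerInclusionAt V p` (E⁺_η); the seam files `…PlusEtaMainConjectureSeam.lean`
(p428136) and `…PlusEtaSeam.lean` prove the `F`-form route items EQUIVALENT to those formulas DISPLAYED.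
This file closes the loop by `fun`-repackaging (the nodes unfold to the displayed formulas):
* §1 **`PlusMainConjectureBranch` (19114) ⟺ ∀ tower rows (C1⁺_η)**, **`PlusMainConjectureNonsurjBranch`
  (19243) ⟺ (C1⁺_η) on the non-onto rows**, **`PlusLowerInclusionSurjBranch` (19242) ⟺ (E⁺_η) on the
  onto rows** — each `↔ ∀ V p, 5 ≤ p → good → a_p = 0 → [row condition] → Node V p`, granted BOTH
  forms of the descent frame (∀-form `hdecA`, g0; ∃-form `hdecE`, k8q-c3 — displayed, WANTED) and the
  NAMED facts Thm. 1.2 (+ Thm. 2.2 at `η` for 19242). These right-hand sides are EXACTLY the texts the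
  planner would file to re-type the items in print currency (TARGET R90 option (a)); the theorems are
  the kernel certificates that the re-typing changes nothing modulo piece (i).
* §2 **the UNIT ROWS in `η`-currency need NO frame**: if every branch function `L_p⁺(V, η, T)` is a
  unit of `Λ` then (E⁺_η) `Char ⊆ (Lη) = Λ` is TRIVIAL (`quadraticBranchPlusEtaLowerInclusionAt_of_isUnit`),
  and with Thm. 2.2 / 4.1 at `η` (named facts) and the tower onto, (C1⁺_η) holds outright
  (`quadraticBranchPlusEtaMainConjectureAt_of_facts_of_surjective_of_isUnit`) — compare g0's `F`-currency
  unit rows (p420208), which needed the frame: in print currency the `r_an(W) = 0`, `p ∤ L(W,1)/Ω_W`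
  rows of 19242 are closed by `le_top`.

HONEST FRAMING (cell `bsd-potss`, run/shared/lean/pub/bsd-potss/; FULL-BSD rank ≤ 1 programme, HUMAN
RULING D-0036/D-0074): TOOL THEOREMS ONLY — no definition, no named fact minted, no `sorry`, axioms
standard. CONDITIONAL on the displayed frames and named facts; the nodes are CONJECTURES asserted for
no curve (§2's unit hypothesis is a per-pair certificate, displayed); items 19114 / 19242 / 19243 and
the route are NOT closed; nothing is booked; `BSD(W, p)` is claimed for no pair; this is not "finishing
BSD". Seat `bsd-potss-k8q-c2` (prover), g2; `--supports stmt-BirchSwinnertonDyer-19242 --as helper`.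

References: [Kobayashi2003] Thm. 1.2 (p. 2), Thm. 2.2 (p. 5), §3 (p. 5), (3.6) (p. 7), §4 Even main
conjecture + Thm. 4.1 (p. 8); [GreenbergLNM1716] §1 (p. 60), §3; [Washington1997] §13.2.
-/

set_option autoImplicit false
set_option linter.dupNamespace false

noncomputable section

open scoped Classical

open CongruenceSubgroup Field WeierstrassCurve
open Literature.NumberTheory.EllipticCurves
open Literature.NumberTheory.EllipticCurves.ModularForms
open Literature.NumberTheory.GaloisRepresentations
open Summit.BirchSwinnertonDyer.Rank1Residual.Additive
open Summit.BirchSwinnertonDyer.Rank1Residual.Additive.SignedTwist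
open Summit.BirchSwinnertonDyer.BirchSwinnertonDyer.Theses.QuadraticBranchSignedControl

namespace Summit.BirchSwinnertonDyer.BirchSwinnertonDyer.Theorems

/-! ## §1 The three items in node currency, granted both frames -/

/-- **Item 19114 `PlusMainConjectureBranch` ⟺ «(C1⁺_η) `QuadraticBranchPlusEtaMainConjectureAt V p`
for every good `a_p = 0` curve `V`, `p ≥ 5`»**, granted both frame forms (`hdecA` ∀-form, `hdecE`
∃-form; displayed, WANTED) and Thm. 1.2 (`h12`, named fact) — `plusMainConjectureBranch_iff_etaMainConjecture_of_frames`
(p428136) with the node folded. The right-hand side is the candidate VERBATIM re-typing of the item.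
CONDITIONAL; closes nothing. [cite: Kobayashi2003, Thm. 1.2 (p. 2), §4 Even main conjecture (p. 8), §3 (p. 5)]
[cite: GreenbergLNM1716, §1 (p. 60) and §3 (descent in prime-to-p extensions; reading)] -/
theorem plusMainConjectureBranch_iff_forall_etaMainConjectureAt_of_frames
    (h12 : Kobayashi2003.thm12_signedSelmerDual_finite_torsion)
    (hdecA : ∀ (p : ℕ) [Fact p.Prime], 5 ≤ p →
      ∀ (K₀ : Type) [Field K₀] [NumberField K₀] [IsCyclotomicExtension {p} ℚ K₀]
        [(galRange (K := ℚ) K₀).Normal] (ηq : absoluteGaloisGroup ℚ →* ℤˣ),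
        (∀ σ ∈ galRange (K := ℚ) K₀, ηq σ = 1) → ηq ≠ 1 →
      ∀ (V : WeierstrassCurve ℚ) [V.IsElliptic] [V.IsGloballyMinimal],
        V.HasGoodReductionAtPrime p → V.frobeniusTrace p = 0 →
      ∀ (κ : ZpExtension ℚ p) (γ : absoluteGaloisGroup ℚ),
        κ.IsCyclotomic → κ.IsTopGenerator γ → γ ∈ galRange (K := ℚ) K₀ →
        IsCyclotomicVariable p γ →
      ∀ (F : Type) [Field F] [NumberField F] (V' : WeierstrassCurve F) [V'.IsElliptic]
        (κF : ZpExtension F p) (γF : absoluteGaloisGroup F),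
        Module.finrank ℚ F = 2 → (∃ θ : F, θ ^ 2 = algebraMap ℚ F ((-1) ^ (p / 2) * p)) →
        (∃ C : VariableChange F, C • V.baseChange F = V') →
        κF.IsCyclotomic → κF.IsTopGenerator γF →
        (∃ ζ : ℤ_[p]ˣ, IsOfFinOrder ζ ∧
          ((GaloisRep.cyclotomicCharacter F p γF * ζ : ℤ_[p]ˣ) : ℤ_[p]) =
            (cyclotomicGenerator p : ℤ_[p])) →
      ∃ Φ : Kobayashi2003.signedSelmerInfty V' κF 1 ≃+
          Kobayashi2003.signedSelmerInfty V κ 1 × towerSignedSelmerInftyEta V κ K₀ ℚ_[p] ηq 1,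
        ∀ s : Kobayashi2003.signedSelmerInfty V' κF 1,
          ((Φ ⟨V'.conjH1 p κF.kerSubgroup γF s,
              Kobayashi2003.conjH1_mem_signedSelmerInfty V' κF 1 γF s.2⟩).1 :
              V.subgroupH1 p κ.kerSubgroup) =
            V.conjH1 p κ.kerSubgroup γ (Φ s).1 ∧
          ((Φ ⟨V'.conjH1 p κF.kerSubgroup γF s,
              Kobayashi2003.conjH1_mem_signedSelmerInfty V' κF 1 γF s.2⟩).2 :
              V.subgroupH1 p (towerTopSubgroup κ K₀)) =
            V.conjH1 p (towerTopSubgroup κ K₀) γ (Φ s).2)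
    (hdecE : ∀ (p : ℕ) [Fact p.Prime], 5 ≤ p →
      ∀ (K₀ : Type) [Field K₀] [NumberField K₀] [IsCyclotomicExtension {p} ℚ K₀]
        [(galRange (K := ℚ) K₀).Normal] (ηq : absoluteGaloisGroup ℚ →* ℤˣ),
        (∀ σ ∈ galRange (K := ℚ) K₀, ηq σ = 1) → ηq ≠ 1 →
      ∀ (V : WeierstrassCurve ℚ) [V.IsElliptic] [V.IsGloballyMinimal],
        V.HasGoodReductionAtPrime p → V.frobeniusTrace p = 0 →
      ∀ (κ : ZpExtension ℚ p) (γ : absoluteGaloisGroup ℚ),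
        κ.IsCyclotomic → κ.IsTopGenerator γ → γ ∈ galRange (K := ℚ) K₀ →
        IsCyclotomicVariable p γ →
      ∃ (F : Type) (_ : Field F) (_ : NumberField F) (V' : WeierstrassCurve F) (_ : V'.IsElliptic)
        (κF : ZpExtension F p) (γF : absoluteGaloisGroup F)
        (Φ : Kobayashi2003.signedSelmerInfty V' κF 1 ≃+
          Kobayashi2003.signedSelmerInfty V κ 1 × towerSignedSelmerInftyEta V κ K₀ ℚ_[p] ηq 1),
        Module.finrank ℚ F = 2 ∧ (∃ θ : F, θ ^ 2 = algebraMap ℚ F ((-1) ^ (p / 2) * p)) ∧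
        (∃ C : VariableChange F, C • V.baseChange F = V') ∧
        κF.IsCyclotomic ∧ κF.IsTopGenerator γF ∧
        (∃ ζ : ℤ_[p]ˣ, IsOfFinOrder ζ ∧
          ((GaloisRep.cyclotomicCharacter F p γF * ζ : ℤ_[p]ˣ) : ℤ_[p]) =
            (cyclotomicGenerator p : ℤ_[p])) ∧
        ∀ s : Kobayashi2003.signedSelmerInfty V' κF 1,
          ((Φ ⟨V'.conjH1 p κF.kerSubgroup γF s,
              Kobayashi2003.conjH1_mem_signedSelmerInfty V' κF 1 γF s.2⟩).1 :
              V.subgroupH1 p κ.kerSubgroup) =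
            V.conjH1 p κ.kerSubgroup γ (Φ s).1 ∧
          ((Φ ⟨V'.conjH1 p κF.kerSubgroup γF s,
              Kobayashi2003.conjH1_mem_signedSelmerInfty V' κF 1 γF s.2⟩).2 :
              V.subgroupH1 p (towerTopSubgroup κ K₀)) =
            V.conjH1 p (towerTopSubgroup κ K₀) γ (Φ s).2) :
    PlusMainConjectureBranch ↔
      ∀ (V : WeierstrassCurve ℚ) [V.IsElliptic] [V.IsGloballyMinimal] (p : ℕ) [Fact p.Prime],
        5 ≤ p → V.HasGoodReductionAtPrime p → V.frobeniusTrace p = 0 →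
        QuadraticBranchPlusEtaMainConjectureAt V p := by
  rw [plusMainConjectureBranch_iff_etaMainConjecture_of_frames h12 hdecA hdecE]
  constructor
  · intro h V _ _ p _ hp5 _ _ K₀ _ _ _ _ ηq hηK hη1 N _ f hp2 hgood hap hf ϖ hϖ Lη hL κ γ hκ hγ hγK hγc D
    exact h p hp5 K₀ ηq hηK hη1 V hp2 hgood hap hf ϖ hϖ Lη hL κ γ hκ hγ hγK hγc D
  · intro h p _ hp5 K₀ _ _ _ _ ηq hηK hη1 V _ _ N _ f hp2 hgood hap hf ϖ hϖ Lη hL κ γ hκ hγ hγK hγc D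
    exact h V p hp5 hgood hap K₀ ηq hηK hη1 hp2 hgood hap hf ϖ hϖ Lη hL κ γ hκ hγ hγK hγc D

/-- **Item 19243 `PlusMainConjectureNonsurjBranch` ⟺ «(C1⁺_η) `QuadraticBranchPlusEtaMainConjectureAt
V p` for every good `a_p = 0` curve `V`, `p ≥ 5`, whose `p`-adic tower is NOT onto»**, granted both
frames and Thm. 1.2 — `plusMainConjectureNonsurjBranch_iff_etaMainConjecture_nonsurj_of_frames`
(p428136) with the node folded; the candidate verbatim re-typing of the declared residual (for CM `V`
literally Pollack–Rubin's remark p. 448). CONDITIONAL; closes nothing.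
[cite: Kobayashi2003, Thm. 1.2 (p. 2), §4 Even main conjecture (p. 8)]
[cite: PollackRubin2004, Theorem and remark p. 448 (CM case; remark only)] -/
theorem plusMainConjectureNonsurjBranch_iff_forall_etaMainConjectureAt_of_frames
    (h12 : Kobayashi2003.thm12_signedSelmerDual_finite_torsion)
    (hdecA : ∀ (p : ℕ) [Fact p.Prime], 5 ≤ p →
      ∀ (K₀ : Type) [Field K₀] [NumberField K₀] [IsCyclotomicExtension {p} ℚ K₀]
        [(galRange (K := ℚ) K₀).Normal] (ηq : absoluteGaloisGroup ℚ →* ℤˣ),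
        (∀ σ ∈ galRange (K := ℚ) K₀, ηq σ = 1) → ηq ≠ 1 →
      ∀ (V : WeierstrassCurve ℚ) [V.IsElliptic] [V.IsGloballyMinimal],
        V.HasGoodReductionAtPrime p → V.frobeniusTrace p = 0 →
      ∀ (κ : ZpExtension ℚ p) (γ : absoluteGaloisGroup ℚ),
        κ.IsCyclotomic → κ.IsTopGenerator γ → γ ∈ galRange (K := ℚ) K₀ →
        IsCyclotomicVariable p γ →
      ∀ (F : Type) [Field F] [NumberField F] (V' : WeierstrassCurve F) [V'.IsElliptic]
        (κF : ZpExtension F p) (γF : absoluteGaloisGroup F),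
        Module.finrank ℚ F = 2 → (∃ θ : F, θ ^ 2 = algebraMap ℚ F ((-1) ^ (p / 2) * p)) →
        (∃ C : VariableChange F, C • V.baseChange F = V') →
        κF.IsCyclotomic → κF.IsTopGenerator γF →
        (∃ ζ : ℤ_[p]ˣ, IsOfFinOrder ζ ∧
          ((GaloisRep.cyclotomicCharacter F p γF * ζ : ℤ_[p]ˣ) : ℤ_[p]) =
            (cyclotomicGenerator p : ℤ_[p])) →
      ∃ Φ : Kobayashi2003.signedSelmerInfty V' κF 1 ≃+
          Kobayashi2003.signedSelmerInfty V κ 1 × towerSignedSelmerInftyEta V κ K₀ ℚ_[p] ηq 1,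
        ∀ s : Kobayashi2003.signedSelmerInfty V' κF 1,
          ((Φ ⟨V'.conjH1 p κF.kerSubgroup γF s,
              Kobayashi2003.conjH1_mem_signedSelmerInfty V' κF 1 γF s.2⟩).1 :
              V.subgroupH1 p κ.kerSubgroup) =
            V.conjH1 p κ.kerSubgroup γ (Φ s).1 ∧
          ((Φ ⟨V'.conjH1 p κF.kerSubgroup γF s,
              Kobayashi2003.conjH1_mem_signedSelmerInfty V' κF 1 γF s.2⟩).2 :
              V.subgroupH1 p (towerTopSubgroup κ K₀)) =
            V.conjH1 p (towerTopSubgroup κ K₀) γ (Φ s).2)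
    (hdecE : ∀ (p : ℕ) [Fact p.Prime], 5 ≤ p →
      ∀ (K₀ : Type) [Field K₀] [NumberField K₀] [IsCyclotomicExtension {p} ℚ K₀]
        [(galRange (K := ℚ) K₀).Normal] (ηq : absoluteGaloisGroup ℚ →* ℤˣ),
        (∀ σ ∈ galRange (K := ℚ) K₀, ηq σ = 1) → ηq ≠ 1 →
      ∀ (V : WeierstrassCurve ℚ) [V.IsElliptic] [V.IsGloballyMinimal],
        V.HasGoodReductionAtPrime p → V.frobeniusTrace p = 0 →
      ∀ (κ : ZpExtension ℚ p) (γ : absoluteGaloisGroup ℚ),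
        κ.IsCyclotomic → κ.IsTopGenerator γ → γ ∈ galRange (K := ℚ) K₀ →
        IsCyclotomicVariable p γ →
      ∃ (F : Type) (_ : Field F) (_ : NumberField F) (V' : WeierstrassCurve F) (_ : V'.IsElliptic)
        (κF : ZpExtension F p) (γF : absoluteGaloisGroup F)
        (Φ : Kobayashi2003.signedSelmerInfty V' κF 1 ≃+
          Kobayashi2003.signedSelmerInfty V κ 1 × towerSignedSelmerInftyEta V κ K₀ ℚ_[p] ηq 1),
        Module.finrank ℚ F = 2 ∧ (∃ θ : F, θ ^ 2 = algebraMap ℚ F ((-1) ^ (p / 2) * p)) ∧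
        (∃ C : VariableChange F, C • V.baseChange F = V') ∧
        κF.IsCyclotomic ∧ κF.IsTopGenerator γF ∧
        (∃ ζ : ℤ_[p]ˣ, IsOfFinOrder ζ ∧
          ((GaloisRep.cyclotomicCharacter F p γF * ζ : ℤ_[p]ˣ) : ℤ_[p]) =
            (cyclotomicGenerator p : ℤ_[p])) ∧
        ∀ s : Kobayashi2003.signedSelmerInfty V' κF 1,
          ((Φ ⟨V'.conjH1 p κF.kerSubgroup γF s,
              Kobayashi2003.conjH1_mem_signedSelmerInfty V' κF 1 γF s.2⟩).1 :
              V.subgroupH1 p κ.kerSubgroup) =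
            V.conjH1 p κ.kerSubgroup γ (Φ s).1 ∧
          ((Φ ⟨V'.conjH1 p κF.kerSubgroup γF s,
              Kobayashi2003.conjH1_mem_signedSelmerInfty V' κF 1 γF s.2⟩).2 :
              V.subgroupH1 p (towerTopSubgroup κ K₀)) =
            V.conjH1 p (towerTopSubgroup κ K₀) γ (Φ s).2) :
    PlusMainConjectureNonsurjBranch ↔
      ∀ (V : WeierstrassCurve ℚ) [V.IsElliptic] [V.IsGloballyMinimal] (p : ℕ) [Fact p.Prime],
        5 ≤ p → V.HasGoodReductionAtPrime p → V.frobeniusTrace p = 0 →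
        ¬ (∀ m : ℕ, V.HasSurjectiveModNGaloisRep (p ^ m : ℕ)) →
        QuadraticBranchPlusEtaMainConjectureAt V p := by
  rw [plusMainConjectureNonsurjBranch_iff_etaMainConjecture_nonsurj_of_frames h12 hdecA hdecE]
  constructor
  · intro h V _ _ p _ hp5 _ _ hns K₀ _ _ _ _ ηq hηK hη1 N _ f hp2 hgood hap hf ϖ hϖ Lη hL κ γ hκ hγ
      hγK hγc D
    exact h p hp5 K₀ ηq hηK hη1 V hp2 hgood hap hns hf ϖ hϖ Lη hL κ γ hκ hγ hγK hγc D
  · intro h p _ hp5 K₀ _ _ _ _ ηq hηK hη1 V _ _ N _ f hp2 hgood hap hns hf ϖ hϖ Lη hL κ γ hκ hγ hγK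
      hγc D
    exact h V p hp5 hgood hap hns K₀ ηq hηK hη1 hp2 hgood hap hf ϖ hϖ Lη hL κ γ hκ hγ hγK hγc D

/-- **Item 19242 `PlusLowerInclusionSurjBranch` ⟺ «(E⁺_η) `QuadraticBranchPlusEtaLowerInclusionAt V p`
for every good `a_p = 0` curve `V`, `p ≥ 5`, whose `p`-adic tower IS onto»**, granted both frames,
Thm. 1.2 and Thm. 2.2 at `η` (named facts) — `plusLowerInclusionSurjBranch_iff_etaLowerInclusion_of_frames`
(`…PlusEtaSeam.lean`) with the node folded; the candidate VERBATIM re-typing of the crux in print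
currency. CONDITIONAL; closes nothing.
[cite: Kobayashi2003, Thm. 1.2 (p. 2), Thm. 2.2 (p. 5), §4 Even main conjecture (p. 8), §3 (p. 5)]
[cite: GreenbergLNM1716, §1 (p. 60) and §3 (descent in prime-to-p extensions; reading)] -/
theorem plusLowerInclusionSurjBranch_iff_forall_etaLowerInclusionAt_of_frames
    (h12 : Kobayashi2003.thm12_signedSelmerDual_finite_torsion)
    (h22 : Kobayashi2003.thm22_etaSignedSelmerDual_finite_torsion)
    (hdecA : ∀ (p : ℕ) [Fact p.Prime], 5 ≤ p →
      ∀ (K₀ : Type) [Field K₀] [NumberField K₀] [IsCyclotomicExtension {p} ℚ K₀]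
        [(galRange (K := ℚ) K₀).Normal] (ηq : absoluteGaloisGroup ℚ →* ℤˣ),
        (∀ σ ∈ galRange (K := ℚ) K₀, ηq σ = 1) → ηq ≠ 1 →
      ∀ (V : WeierstrassCurve ℚ) [V.IsElliptic] [V.IsGloballyMinimal],
        V.HasGoodReductionAtPrime p → V.frobeniusTrace p = 0 →
      ∀ (κ : ZpExtension ℚ p) (γ : absoluteGaloisGroup ℚ),
        κ.IsCyclotomic → κ.IsTopGenerator γ → γ ∈ galRange (K := ℚ) K₀ →
        IsCyclotomicVariable p γ →
      ∀ (F : Type) [Field F] [NumberField F] (V' : WeierstrassCurve F) [V'.IsElliptic]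
        (κF : ZpExtension F p) (γF : absoluteGaloisGroup F),
        Module.finrank ℚ F = 2 → (∃ θ : F, θ ^ 2 = algebraMap ℚ F ((-1) ^ (p / 2) * p)) →
        (∃ C : VariableChange F, C • V.baseChange F = V') →
        κF.IsCyclotomic → κF.IsTopGenerator γF →
        (∃ ζ : ℤ_[p]ˣ, IsOfFinOrder ζ ∧
          ((GaloisRep.cyclotomicCharacter F p γF * ζ : ℤ_[p]ˣ) : ℤ_[p]) =
            (cyclotomicGenerator p : ℤ_[p])) →
      ∃ Φ : Kobayashi2003.signedSelmerInfty V' κF 1 ≃+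
          Kobayashi2003.signedSelmerInfty V κ 1 × towerSignedSelmerInftyEta V κ K₀ ℚ_[p] ηq 1,
        ∀ s : Kobayashi2003.signedSelmerInfty V' κF 1,
          ((Φ ⟨V'.conjH1 p κF.kerSubgroup γF s,
              Kobayashi2003.conjH1_mem_signedSelmerInfty V' κF 1 γF s.2⟩).1 :
              V.subgroupH1 p κ.kerSubgroup) =
            V.conjH1 p κ.kerSubgroup γ (Φ s).1 ∧
          ((Φ ⟨V'.conjH1 p κF.kerSubgroup γF s,
              Kobayashi2003.conjH1_mem_signedSelmerInfty V' κF 1 γF s.2⟩).2 :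
              V.subgroupH1 p (towerTopSubgroup κ K₀)) =
            V.conjH1 p (towerTopSubgroup κ K₀) γ (Φ s).2)
    (hdecE : ∀ (p : ℕ) [Fact p.Prime], 5 ≤ p →
      ∀ (K₀ : Type) [Field K₀] [NumberField K₀] [IsCyclotomicExtension {p} ℚ K₀]
        [(galRange (K := ℚ) K₀).Normal] (ηq : absoluteGaloisGroup ℚ →* ℤˣ),
        (∀ σ ∈ galRange (K := ℚ) K₀, ηq σ = 1) → ηq ≠ 1 →
      ∀ (V : WeierstrassCurve ℚ) [V.IsElliptic] [V.IsGloballyMinimal],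
        V.HasGoodReductionAtPrime p → V.frobeniusTrace p = 0 →
      ∀ (κ : ZpExtension ℚ p) (γ : absoluteGaloisGroup ℚ),
        κ.IsCyclotomic → κ.IsTopGenerator γ → γ ∈ galRange (K := ℚ) K₀ →
        IsCyclotomicVariable p γ →
      ∃ (F : Type) (_ : Field F) (_ : NumberField F) (V' : WeierstrassCurve F) (_ : V'.IsElliptic)
        (κF : ZpExtension F p) (γF : absoluteGaloisGroup F)
        (Φ : Kobayashi2003.signedSelmerInfty V' κF 1 ≃+
          Kobayashi2003.signedSelmerInfty V κ 1 × towerSignedSelmerInftyEta V κ K₀ ℚ_[p] ηq 1),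
        Module.finrank ℚ F = 2 ∧ (∃ θ : F, θ ^ 2 = algebraMap ℚ F ((-1) ^ (p / 2) * p)) ∧
        (∃ C : VariableChange F, C • V.baseChange F = V') ∧
        κF.IsCyclotomic ∧ κF.IsTopGenerator γF ∧
        (∃ ζ : ℤ_[p]ˣ, IsOfFinOrder ζ ∧
          ((GaloisRep.cyclotomicCharacter F p γF * ζ : ℤ_[p]ˣ) : ℤ_[p]) =
            (cyclotomicGenerator p : ℤ_[p])) ∧
        ∀ s : Kobayashi2003.signedSelmerInfty V' κF 1,
          ((Φ ⟨V'.conjH1 p κF.kerSubgroup γF s,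
              Kobayashi2003.conjH1_mem_signedSelmerInfty V' κF 1 γF s.2⟩).1 :
              V.subgroupH1 p κ.kerSubgroup) =
            V.conjH1 p κ.kerSubgroup γ (Φ s).1 ∧
          ((Φ ⟨V'.conjH1 p κF.kerSubgroup γF s,
              Kobayashi2003.conjH1_mem_signedSelmerInfty V' κF 1 γF s.2⟩).2 :
              V.subgroupH1 p (towerTopSubgroup κ K₀)) =
            V.conjH1 p (towerTopSubgroup κ K₀) γ (Φ s).2) :
    PlusLowerInclusionSurjBranch ↔
      ∀ (V : WeierstrassCurve ℚ) [V.IsElliptic] [V.IsGloballyMinimal] (p : ℕ) [Fact p.Prime],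
        5 ≤ p → V.HasGoodReductionAtPrime p → V.frobeniusTrace p = 0 →
        (∀ m : ℕ, V.HasSurjectiveModNGaloisRep (p ^ m : ℕ)) →
        QuadraticBranchPlusEtaLowerInclusionAt V p := by
  rw [plusLowerInclusionSurjBranch_iff_etaLowerInclusion_of_frames h12 h22 hdecA hdecE]
  constructor
  · intro h V _ _ p _ hp5 _ _ hs K₀ _ _ _ _ ηq hηK hη1 N _ f hp2 hgood hap hf ϖ hϖ Lη hL κ γ hκ hγ
      hγK hγc D
    exact h p hp5 K₀ ηq hηK hη1 V hp2 hgood hap hs hf ϖ hϖ Lη hL κ γ hκ hγ hγK hγc D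
  · intro h p _ hp5 K₀ _ _ _ _ ηq hηK hη1 V _ _ N _ f hp2 hgood hap hs hf ϖ hϖ Lη hL κ γ hκ hγ hγK
      hγc D
    exact h V p hp5 hgood hap hs K₀ ηq hηK hη1 hp2 hgood hap hf ϖ hϖ Lη hL κ γ hκ hγ hγK hγc D

/-! ## §2 The unit rows in `η`-currency — no frame -/

section UnitRows

variable {V : WeierstrassCurve ℚ} [V.IsElliptic] [V.IsGloballyMinimal] {p : ℕ} [Fact p.Prime]

/-- **(E⁺_η) on a unit row is TRIVIAL**: if every function with the interpolation property of
`L_p⁺(V, η, T)` (for the newform of `V` and the period ratio of the parity of `η`) is a UNIT of `Λ`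
(`μ = λ = 0`; by (3.6) and the cell's value identity: `ord_p(L(W,1)/Ω_W) = 0` for the additive twist
`W`, a per-pair certificate — displayed), then `Char(X⁺(V/K_∞)^η) ⊆ (Lη) = Λ` for every `η`-datum. No
descent frame, no finiteness theorem, no Euler system. CONDITIONAL on the displayed unit hypothesis;
closes nothing. [cite: Kobayashi2003, (3.6) (p. 7) and §4 Even main conjecture (p. 8)] -/
theorem quadraticBranchPlusEtaLowerInclusionAt_of_isUnit
    (hunit : ∀ {N : ℕ} [NeZero N] {f : CuspForm (Gamma0 N) 2}, IsNewformOf V f →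
      ∀ (ϖ : ℚ), (if Even (p / 2) then (ϖ : ℝ) * V.realPeriodRat = plusPeriod f
          else (ϖ : ℝ) * V.imaginaryPeriodRat = minusPeriod f) →
      ∀ (Lη : IwasawaAlgebra p), IsQuadraticBranchPlusLFunction f p ϖ Lη → IsUnit Lη) :
    QuadraticBranchPlusEtaLowerInclusionAt V p := by
  intro K₀ _ _ _ _ ηq hηK hη1 N _ f hp2 hgood hap hf ϖ hϖ Lη hL κ γ hκ hγ hγK hγc D
  rw [Ideal.span_singleton_eq_top.mpr (hunit hf ϖ hϖ Lη hL)]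
  exact le_top

/-- **(C1⁺_η) on a tower-onto unit row from Thm. 2.2 / Thm. 4.1 at `η` alone** (NAMED facts
`thm22_etaSignedSelmerDual_finite_torsion`, `thm41_plusEtaCharIdeal_dvd`, hypothesis position): if
`ρ_{V,p^m}` is onto for every `m` and every branch function `L_p⁺(V, η, T)` is a unit (displayed
certificate), then Kobayashi's even main conjecture at `η` holds AT THIS PAIR — `Char = Λ = (Lη)`:
`⊆` is `le_top`, `⊇` is Thm. 4.1 with `n = 0`, finiteness is Thm. 2.2
(`quadraticBranchPlusEtaMainConjectureAt_of_facts_of_surjective_of_etaLowerInclusion`, node file). No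
frame. CONDITIONAL; closes nothing; on these rows `BSD(W,p)` is the unit case anyway — anatomy, not a
closure claim. [cite: Kobayashi2003, Thm. 2.2 (p. 5), Thm. 4.1 and §4 Even main conjecture (p. 8)] -/
theorem quadraticBranchPlusEtaMainConjectureAt_of_facts_of_surjective_of_isUnit
    (h22 : Kobayashi2003.thm22_etaSignedSelmerDual_finite_torsion)
    (h41 : Kobayashi2003.thm41_plusEtaCharIdeal_dvd)
    (hsurj : ∀ m : ℕ, V.HasSurjectiveModNGaloisRep (p ^ m : ℕ))
    (hunit : ∀ {N : ℕ} [NeZero N] {f : CuspForm (Gamma0 N) 2}, IsNewformOf V f →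
      ∀ (ϖ : ℚ), (if Even (p / 2) then (ϖ : ℝ) * V.realPeriodRat = plusPeriod f
          else (ϖ : ℝ) * V.imaginaryPeriodRat = minusPeriod f) →
      ∀ (Lη : IwasawaAlgebra p), IsQuadraticBranchPlusLFunction f p ϖ Lη → IsUnit Lη) :
    QuadraticBranchPlusEtaMainConjectureAt V p :=
  quadraticBranchPlusEtaMainConjectureAt_of_facts_of_surjective_of_etaLowerInclusion h22 h41 hsurj
    (quadraticBranchPlusEtaLowerInclusionAt_of_isUnit hunit)

end UnitRows

end Summit.BirchSwinnertonDyer.BirchSwinnertonDyer.Theorems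

end
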